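import Summits.CriticalPhenomena.SAWScalingLimit.Theses.SAWDefectDecoherence
import Summits.CriticalPhenomena.SAWScalingLimit.Theorems.ObservableToSLE.Negative.Identification

/-!
# Crux `ObservableToSLER` (stmt-CriticalPhenomena-14005): why the `b`-normalisation works, and a lattice dictionary gap

Negative / boundary lemmas (refuter, cdisprove cycle 1) for the glue crux
`ObservableToSLER : HexObservableLimitR → HexTight → ⟨DCS 2012 Conjecture 1⟩`, whose intended proof
runs the `b`-normalised parafermionic observable `F_{Ω∖γ[0,n]}(z)/F_{Ω∖γ[0,n]}(b)` as a martingale and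
reads off the driving process by Itô calculus on `g_t′(z)^{5/8} (g_t(z) − W_t)^{−5/4}`.

§1 MECHANISM ALGEBRA.  Under Loewner's equation `∂_t g_t = 2/(g_t − W_t)`, `W = √κ B`, with
`X = g_t(z) − W_t`, `U = g_t(u) − W_t` (`u` a boundary point), `d log g_t′(z) = −2/X² dt`,
`d log g_t′(u) = −2/U² dt`, `dX = 2/X dt − dW`, `dU = 2/U dt − dW`, `d⟨X⟩ = d⟨U⟩ = d⟨X,U⟩ = κ dt`:
* `itoDrift α β κ` = drift of `g′^α X^β` (per `dt`, divided by `g′^α X^{β−2}`);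
  `itoDrift_eq_zero_iff`: at `(α, β) = (5/8, −5/4)` it vanishes iff `κ = 8/3`;
* `ratioDrift α β κ X U` = drift of the RATIO `g′(z)^α X^β g′(u)^{−α} U^{−β}` (the observable
  normalised at `u`), per `dt` divided by the ratio; **`ratioDrift_eq`**: at `(5/8, −5/4, 8/3)` it is
  `(25/6)(X − U)/(X U²)`, NONZERO for `z ≠ u` (`ratioDrift_ne_zero`) and `→ 0` as `U → ∞`
  (`tendsto_ratioDrift_atTop`).  Reading: normalising at a boundary point that is NOT the target of
  the curve destroys the martingale property in the continuum; the `b`-normalisation of the crux is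
  load-bearing and works exactly because `b = pt 1` is the SLE target (hydrodynamic tangency).
§2 DICTIONARY GAP.  `HexObservableLimitR` pins the discretisation to the exact half-lattice
`v ∈ Λ δ ↔ m ≤ v.1 1` near each marked point, while `hexSAWLaw` lives on the CANONICAL `Ω_δ`:
`canonical_halfLattice_height_zero` (height `0`: canonical = exact half-lattice `{x₁ ≥ 0}` at every
mesh) but `canonical_not_halfLattice` (a flat piece at ANY height `y > 0` splits row `k` at the mesh
`δ_k = y/((√3/2)(k + 1/2))`, `tendsto_splitMesh`: `δ_k → 0`), so along `δ_k` the hypothesis never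
speaks about `Ω_δ` itself for marked points off height `0`.
-/

noncomputable section

open Literature.Probability.RandomPlanarGeometry Literature.Probability.RandomPlanarGeometry.SAW
  Literature.Probability.LatticeModels MeasureTheory Filter Topology Set

namespace Summit.CriticalPhenomena.SAWScalingLimit.Theorems.ObservableToSLER.Negative

open Summit.CriticalPhenomena.SAWScalingLimit.Theorems.ObservableToSLE.Negative

/-! ## §1 Itô drift of the observable and of its normalised ratio -/

/-- Drift coefficient of `g′^α (g − W)^β`: `−2α + 2β + κ β(β−1)/2`. -/
def itoDrift (α β κ : ℝ) : ℝ := -2 * α + 2 * β + κ * β * (β - 1) / 2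

/-- With the parafermionic data `(α, β) = (5/8, −5/4)` the observable is a local martingale iff
`κ = 8/3` (LSW 2003 Prop. 5.2-type arithmetic). [folklore] -/
theorem itoDrift_eq_zero_iff (κ : ℝ) : itoDrift (5 / 8) (-5 / 4) κ = 0 ↔ κ = 8 / 3 := by
  unfold itoDrift
  constructor <;> intro h <;> linarith

/-- The general family: for `β(β−1) ≠ 0` the drift vanishes iff `κ = 4(α − β)/(β(β − 1))`. [folklore] -/
theorem itoDrift_family {α β : ℝ} (hβ : β * (β - 1) ≠ 0) (κ : ℝ) :
    itoDrift α β κ = 0 ↔ κ = 4 * (α - β) / (β * (β - 1)) := by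
  unfold itoDrift
  rw [eq_div_iff hβ]
  constructor <;> intro h <;> linarith

/-- Drift per `dt` (divided by `N`) of the ratio `N = g′(z)^α X^β g′(u)^{−α} U^{−β}` — the
observable normalised at the boundary point `u`:
`itoDrift/X² + (2α − 2β + κβ(β+1)/2)/U² − κβ²/(XU)` (Itô with the cross-variation term). -/
def ratioDrift (α β κ X U : ℝ) : ℝ :=
  itoDrift α β κ / X ^ 2 + (2 * α - 2 * β + κ * β * (β + 1) / 2) / U ^ 2 - κ * β ^ 2 / (X * U)

/-- **NORMALISING AT A NON-TARGET BOUNDARY POINT LEAVES A DRIFT.** At `(α, β, κ) = (5/8, −5/4, 8/3)`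
the ratio drift is `(25/6)(X − U)/(X U²)`. [folklore] -/
theorem ratioDrift_eq {X U : ℝ} (hX : X ≠ 0) (hU : U ≠ 0) :
    ratioDrift (5 / 8) (-5 / 4) (8 / 3) X U = 25 / 6 * (X - U) / (X * U ^ 2) := by
  unfold ratioDrift itoDrift
  field_simp
  ring

/-- … which is NONZERO for every bulk point `z ≠ u`: the `b`-normalised observable is a continuum
local martingale only because `b` is the TARGET of the curve. [folklore] -/
theorem ratioDrift_ne_zero {X U : ℝ} (hX : X ≠ 0) (hU : U ≠ 0) (hXU : X ≠ U) :
    ratioDrift (5 / 8) (-5 / 4) (8 / 3) X U ≠ 0 := by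
  rw [ratioDrift_eq hX hU]
  have h1 : X - U ≠ 0 := sub_ne_zero.2 hXU
  have h2 : X * U ^ 2 ≠ 0 := mul_ne_zero hX (pow_ne_zero 2 hU)
  exact div_ne_zero (mul_ne_zero (by norm_num) h1) h2

/-- **HYDRODYNAMIC TANGENCY.** As the normalisation point tends to the target (`U → ∞` in the
half-plane picture, where the target is `∞`), the ratio drift vanishes: normalising at the target
`b = pt 1` is exactly what makes `F(z)/F(b)` driftless at `κ = 8/3`. [folklore] -/
theorem tendsto_ratioDrift_atTop {X : ℝ} (hX : X ≠ 0) :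
    Tendsto (fun U : ℝ => ratioDrift (5 / 8) (-5 / 4) (8 / 3) X U) atTop (𝓝 0) := by
  have h : (fun U : ℝ => ratioDrift (5 / 8) (-5 / 4) (8 / 3) X U) =ᶠ[atTop]
      fun U : ℝ => 25 / 6 * (U⁻¹ * U⁻¹) - 25 / 6 * X⁻¹ * U⁻¹ := by
    filter_upwards [eventually_ne_atTop (0 : ℝ)] with U hU
    rw [ratioDrift_eq hX hU]
    field_simp
  rw [tendsto_congr' h]
  have h0 : Tendsto (fun U : ℝ => U⁻¹) atTop (𝓝 0) := tendsto_inv_atTop_zero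
  have h1 : Tendsto (fun U : ℝ => 25 / 6 * (U⁻¹ * U⁻¹)) atTop (𝓝 (25 / 6 * (0 * 0))) :=
    (h0.mul h0).const_mul _
  have h2 : Tendsto (fun U : ℝ => 25 / 6 * X⁻¹ * U⁻¹) atTop (𝓝 (25 / 6 * X⁻¹ * 0)) :=
    h0.const_mul _
  simpa using h1.sub h2

/-! ## §2 Exact half-lattice clause versus the canonical discretisation -/

/-- At height `0` the canonical hexagonal discretisation of an upper half-plane piece IS the exact
half-lattice `{x₁ ≥ 0}` at every mesh: the good case of the clause `v ∈ Λ δ ↔ m ≤ v.1 1`. [folklore] -/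
theorem canonical_halfLattice_height_zero {δ : ℝ} (hδ : 0 < δ) (v : HexVertex) :
    0 < ((δ : ℂ) * hexCenter v).im ↔ 0 ≤ v.1 1 := by
  obtain ⟨x, k⟩ := v
  rw [Complex.im_ofReal_mul, (hexCenter_re_im x k).2]
  have h3 : 0 < Real.sqrt 3 / 2 := by positivity
  have hk : ((k : ℕ) : ℝ) = 0 ∨ ((k : ℕ) : ℝ) = 1 := by
    fin_cases k <;> simp
  constructor
  · intro h
    have h' : 0 < (x 1 : ℝ) + (((k : ℕ) : ℝ) + 1) / 3 := by
      by_contra hle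
      push Not at hle
      have := mul_nonpos_of_nonneg_of_nonpos (mul_pos hδ h3).le hle
      nlinarith [mul_pos hδ h3]
    have hx : (-1 : ℝ) < x 1 := by rcases hk with hk | hk <;> rw [hk] at h' <;> linarith
    exact_mod_cast (show (-1 : ℤ) < x 1 by exact_mod_cast hx)
  · intro h
    have hx : (0 : ℝ) ≤ x 1 := by exact_mod_cast h
    have h' : 0 < (x 1 : ℝ) + (((k : ℕ) : ℝ) + 1) / 3 := by rcases hk with hk | hk <;> rw [hk] <;> linarith
    exact mul_pos hδ (mul_pos h3 h')

/-- **A FLAT PIECE AT POSITIVE HEIGHT SPLITS LATTICE ROWS ALONG A SEQUENCE OF MESHES.** For every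
height `y > 0` and every row index `k`, at the mesh `δ_k = y / ((√3/2)(k + 1/2))` the canonical
discretisation `{v : y < im(δ_k · c_v)}` of the half-plane `{im z > y}` is NOT of the form
`{v : m ≤ v.1 1}`: row `k` is split between its two sublattices.  So for a Dobrushin domain flat
near a marked point at height `y ≠ 0`, the exact-half-lattice clause of `HexObservableLimitR`
excludes the canonical `Ω_δ` along `δ_k → 0⁺` — the hypothesis then never speaks about the domain
of `hexSAWLaw` itself at those meshes (a dictionary gap on top of W1/W2). [folklore] -/
theorem canonical_not_halfLattice {y : ℝ} (hy : 0 < y) (k : ℕ) :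
    ¬ ∃ m : ℤ, ∀ v : HexVertex,
      (y < (((y / (Real.sqrt 3 / 2 * ((k : ℝ) + 1 / 2)) : ℝ) : ℂ) * hexCenter v).im ↔ m ≤ v.1 1) := by
  rintro ⟨m, hm⟩
  have h3 : 0 < Real.sqrt 3 / 2 := by positivity
  have hden : 0 < Real.sqrt 3 / 2 * ((k : ℝ) + 1 / 2) := by positivity
  set δ : ℝ := y / (Real.sqrt 3 / 2 * ((k : ℝ) + 1 / 2)) with hδ
  have hδpos : 0 < δ := div_pos hy hden
  have him : ∀ t : Fin 2, ((δ : ℂ) * hexCenter (![0, (k : ℤ)], t)).im =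
      δ * (Real.sqrt 3 / 2 * ((k : ℝ) + (((t : ℕ) : ℝ) + 1) / 3)) := by
    intro t
    rw [Complex.im_ofReal_mul, (hexCenter_re_im _ t).2]
    simp
  -- the upper sublattice of row `k` is inside
  have hin : y < ((δ : ℂ) * hexCenter (![0, (k : ℤ)], (1 : Fin 2))).im := by
    rw [him]
    have : y = δ * (Real.sqrt 3 / 2 * ((k : ℝ) + 1 / 2)) := by
      rw [hδ, div_mul_cancel₀ _ hden.ne']
    rw [this]
    refine mul_lt_mul_of_pos_left (mul_lt_mul_of_pos_left ?_ h3) hδpos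
    simp
    norm_num
  -- the lower sublattice of row `k` is outside
  have hout : ¬ y < ((δ : ℂ) * hexCenter (![0, (k : ℤ)], (0 : Fin 2))).im := by
    rw [him, not_lt]
    have : y = δ * (Real.sqrt 3 / 2 * ((k : ℝ) + 1 / 2)) := by
      rw [hδ, div_mul_cancel₀ _ hden.ne']
    rw [this]
    refine mul_le_mul_of_nonneg_left (mul_le_mul_of_nonneg_left ?_ h3.le) hδpos.le
    simp
    norm_num
  have h1 : m ≤ (k : ℤ) := by simpa using (hm (![0, (k : ℤ)], (1 : Fin 2))).1 hin
  exact hout ((hm (![0, (k : ℤ)], (0 : Fin 2))).2 (by simpa using h1))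

/-- The splitting meshes tend to `0`: the obstruction recurs at arbitrarily small scales. [folklore] -/
theorem tendsto_splitMesh {y : ℝ} :
    Tendsto (fun k : ℕ => y / (Real.sqrt 3 / 2 * ((k : ℝ) + 1 / 2))) atTop (𝓝 0) := by
  have h : Tendsto (fun k : ℕ => Real.sqrt 3 / 2 * ((k : ℝ) + 1 / 2)) atTop atTop := by
    refine Tendsto.const_mul_atTop (by positivity) ?_
    exact tendsto_atTop_add_const_right _ _ tendsto_natCast_atTop_atTop
  exact h.inv_tendsto_atTop.const_mul y |>.congr (fun k => by simp [div_eq_mul_inv]) |>.trans (by simp)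

end Summit.CriticalPhenomena.SAWScalingLimit.Theorems.ObservableToSLER.Negative
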